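import Summits.QuantumFields.BalabanUV.T4Continuum.Support.NE7AllMinimisersCubeReg910
import HarnessLib

/-!
# NE7AllMinimisersCubeReg910Full — gen 112's headline WITH THE SECOND PRINTED CLAUSE OF (10): for every constrained small-field minimiser, about every point, in the local
# Landau chart of `NE7AllMinimisersCubeReg910`: (9)₁, (9)₂, (10)_Δ `‖Δ^{lattice}A‖ ≤ C₂ε∕M³`, (10)_{∂*∂} `‖Σ_μ[dA(y;μ,ν) − dA(y−e_μ;μ,ν)]‖ ≤ C₂ε∕M³` (print's `|∂^{η*}∂^ηA|`), and (9)₃ for every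
# `β < 1` — k-uniform, no displayed letter (addendum file; same route, same constants)

Cell `pub-balaban`, rung (B)+1 sub-cell t4, lineage `b2b-balaban-t4-ne7-p1` (CRUX PROVER NE7 #1 = OWNER of BINDER row NE7), generation 112.  Memo
`t4/b2b-balaban-t4-ne7-p1-g112/ROAD-G112.md` §6(b).  [Balaban1985Variational] (10) p. 279 displays TWO quantities, `|∂^{η*}∂^ηA|` and `|Δ^ηA|`; in lattice units `∂^{η*}∂^ηA` is the
co-differential of the linear curl, `Σ_μ [dA(y;μ,ν) − dA(y−e_μ;μ,ν)]`, and `ΔA_ν = (∂*∂A)_ν + (∂∂*A)_ν` ((156) §1).  G3b `all_minimisers_cube_reg910` filed the `Δ` clause; THIS file re-runs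
its docking proof (verbatim) and adds the `∂*∂` clause, read off G1b `NE7LocalLandauGradientLetter.local_curl_div_bounds` (J) at `x₀ = z`, `R = 7M` with the half-cube gradient bound:
`(J) ≤ j_ε + 4d(e^{4a₀}−1)G₁ ≤ Λ ≤ C₂ε∕M³`.
WHAT ([folklore]; 0 def, 0 sorry; d = 4, every U(n), L ≥ 2).  **`all_minimisers_cube_reg910_full`** — G3b's statement with the extra conjunct.
HONEST FRAMING (page 1): as G3b — OUR minimisers, OUR route; β = 1 NOT reached; nothing of Bałaban's asserted; NOT NE3∕NE7 as spine nodes; spine 0∕9; finite T⁴ rung (B)+1 — NOT infinite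
volume, NOT mass gap, NOT BetaPertH, NOT Clay (continuum YM on T⁴ ⇐ BetaPertH ∧ nine spine estimates).
-/

set_option autoImplicit false

open NormedSpace
open scoped BigOperators Matrix Matrix.Norms.L2Operator
open Finset

namespace Summit.QuantumFields.BalabanUV.T4Continuum.NE7AllMinimisersCubeReg910Full

open Literature.MathematicalPhysics.QuantumFieldTheory.Balaban1983to89
open B7Prop1Explicit B7Prop2Explicit
open B8Ineq132 (covDiv norm_covDiv_gaugeAct)
open T4AveragingDeficitWall (SmallField IsUnitaryCfg)
open T4AveragingDeficitWallBoundary (IsPeriodicCfg)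
open AveragingDeficitTransport (mem_U1_of_unitary)
open BlockAverageCurrent (smallField_gaugeAct)
open Beta.PoissonInterior (cube mem_cube mem_cube_iff_supNorm supNorm)
open MinimalActionSandwich (IsMinimiser admissible)
open MinimalActionRate (sfClass)
open NE7CubeLandauChart (cube_landau_chart)
open NE7CubeLandauReg910 (cube_landau_reg910 near_iff_supNorm)
open NE7Reg10ImpliesReg9 (rpow_scaling)
open NE7AllMinimisersRegularSpaceGeneric (all_minimisers_regularSpace_generic)
open NE7LocalLandauLetters (near_mono near_trans near_sub_e)
open NE7LocalLandauGradientLetter (local_curl_div_bounds)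
open NE7AllMinimisersCubeReg910 (regime_chart raw_bounds)

noncomputable section

variable {n : Type} [Fintype n] [DecidableEq n] [Nonempty n]

/-- **G3b's headline with both printed clauses of (10)** — see the module docstring. [folklore] -/
theorem all_minimisers_cube_reg910_full {L : ℕ} (hL : 2 ≤ L) :
    ∃ C₀ C₁ C₂ C₃ : ℝ, 0 ≤ C₀ ∧ 0 ≤ C₁ ∧ 0 ≤ C₂ ∧ 0 ≤ C₃ ∧ ∃ ε₀ : ℝ, 0 < ε₀ ∧ ∀ ε : ℝ, 0 < ε → ε ≤ ε₀ → ∀ (N : ℕ) [NeZero N], 1 ≤ N →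
      ∃ δV : ℝ, 0 < δV ∧
        ∀ V ∈ {V : Site 4 → Fin 4 → (Matrix n n ℂ)ˣ | IsUnitaryCfg V ∧ IsPeriodicCfg V (N : ℤ) ∧ SmallField V δV},
        ∀ (k : ℕ) (U : Site 4 → Fin 4 → (Matrix n n ℂ)ˣ), IsMinimiser 4 (sfClass 4 L N ε) L N k V U → ∀ z : Site 4,
        ∃ (u : Site 4 → (Matrix n n ℂ)ˣ) (A : Site 4 → Fin 4 → Matrix n n ℂ), (∀ x, u x ∈ unitaryUnits (Matrix n n ℂ)) ∧
          (∀ (x : Site 4) (κ : Fin 4), (∀ i, |x i - z i| ≤ ((16 * L ^ k + 5 : ℕ) : ℤ)) → gaugeAct u U x κ = expUnit (A x κ)) ∧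
          (∀ (x : Site 4) (κ : Fin 4), (∀ i, |x i - z i| ≤ ((16 * L ^ k + 5 : ℕ) : ℤ)) → A x κ ∈ skewAdjoint (Matrix n n ℂ)) ∧
          (∀ (x : Site 4) (κ : Fin 4), (∀ i, |x i - z i| ≤ ((16 * L ^ k + 5 : ℕ) : ℤ)) → ‖A x κ‖ ≤ C₀ * ε / (L : ℝ) ^ k) ∧
          (∀ x : Site 4, 2 * supNorm (x - z) ≤ 16 * L ^ k → ∀ κ τ : Fin 4, ‖A (x + e τ) κ - A x κ‖ ≤ C₁ * ε / ((L : ℝ) ^ k) ^ 2) ∧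
          (∀ y : Site 4, supNorm (y - z) ≤ 7 * L ^ k → ∀ ν : Fin 4,
            ‖∑ i, ((A (y + e i) ν - A y ν) - (A y ν - A (y - e i) ν))‖ ≤ C₂ * ε / ((L : ℝ) ^ k) ^ 3) ∧
          (∀ y : Site 4, supNorm (y - z) ≤ 7 * L ^ k → ∀ ν : Fin 4,
            ‖∑ μ, ((A y μ + A (y + e μ) ν - A (y + e ν) μ - A y ν)
                    - (A (y - e μ) μ + A (y - e μ + e μ) ν - A (y - e μ + e ν) μ - A (y - e μ) ν))‖ ≤ C₂ * ε / ((L : ℝ) ^ k) ^ 3) ∧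
          (∀ β : ℝ, 0 ≤ β → β < 1 → ∀ z₁ z₂ : Site 4, z₁ ∈ cube z (L ^ k - 1) → z₂ ∈ cube z (L ^ k - 1) → ∀ μ κ : Fin 4,
            ‖(A (z₁ + e μ) κ - A z₁ κ) - (A (z₂ + e μ) κ - A z₂ κ)‖
              ≤ C₃ * (1 + (1 - β)⁻¹) * ε * (supNorm (z₁ - z₂) : ℝ) ^ β / ((L : ℝ) ^ k) ^ (2 + β)) := by
  obtain ⟨C, hC, hG3a⟩ := cube_landau_reg910 (d := 4) (n := n) (by norm_num)
  obtain ⟨CJ, hCJ, ε₁, hε₁, H⟩ := all_minimisers_regularSpace_generic (n := n) hL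
  set cn : ℝ := (Fintype.card n : ℝ) with hcn
  have hcn1 : 1 ≤ cn := by rw [hcn]; exact_mod_cast Fintype.card_pos
  set c : ℝ := (cn + 1) * (CJ + 1) with hcdef
  have hc1 : 1 ≤ c := by rw [hcdef]; nlinarith
  have hcnc : cn ≤ c := by rw [hcdef]; nlinarith
  have hCJc : CJ + 1 ≤ c := by rw [hcdef]; nlinarith
  have hc0 : 0 < c := by linarith
  refine ⟨737280, 6635520 + 64 * (CJ + 1), CJ + 2, 3 * C * (CJ + 2 + 737280), by norm_num, by positivity, by positivity, by positivity,
    min ε₁ (1 / (10 ^ 16 * c)), lt_min hε₁ (by positivity), fun ε hε hεle N _ hN => ?_⟩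
  have hεε₁ : ε ≤ ε₁ := hεle.trans (min_le_left _ _)
  have hsmall : 10 ^ 16 * c * ε ≤ 1 := by
    have h1 : ε ≤ 1 / (10 ^ 16 * c) := hεle.trans (min_le_right _ _)
    rw [le_div_iff₀ (by positivity)] at h1
    linarith
  obtain ⟨δV, hδV, HV⟩ := H ε hε hεε₁ N hN
  refine ⟨δV, hδV, fun V hV k U hmin z => ?_⟩
  obtain ⟨hSF, hcov⟩ := HV V hV k U hmin
  have hcls : U ∈ sfClass 4 L N ε k := hmin.mem.1
  simp only [sfClass, Set.mem_setOf_eq] at hcls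
  obtain ⟨hU, -, -⟩ := hcls
  -- scales
  have hL1 : (1 : ℝ) ≤ L := by exact_mod_cast (by omega : 1 ≤ L)
  have hMr1 : (1 : ℝ) ≤ (L : ℝ) ^ k := one_le_pow₀ hL1
  have hMr0 : (0 : ℝ) < (L : ℝ) ^ k := by positivity
  have hMn1 : 1 ≤ L ^ k := Nat.one_le_pow _ _ (by omega)
  have hMcast : ((L ^ k : ℕ) : ℝ) = (L : ℝ) ^ k := by push_cast; ring
  set R : ℕ := 16 * L ^ k + 5 with hRdef
  have hη : 0 < ε / ((L : ℝ) ^ k) ^ 2 := by positivity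
  -- the chart regime
  have hX : ((2 * R + 2 + 1 : ℕ) : ℝ) ≤ 45 * (L : ℝ) ^ k := by
    rw [hRdef]; push_cast; nlinarith
  have hX1 : (1 : ℝ) ≤ ((2 * R + 2 + 1 : ℕ) : ℝ) := by exact_mod_cast (by omega : 1 ≤ 2 * R + 2 + 1)
  have hX₂ : ((2 * R + 2 : ℕ) : ℝ) ≤ 45 * (L : ℝ) ^ k := by
    rw [hRdef]; push_cast; nlinarith
  have hX₂0 : (0 : ℝ) ≤ ((2 * R + 2 : ℕ) : ℝ) := Nat.cast_nonneg _
  obtain ⟨hc1', hc2', hc3', hc4'⟩ := regime_chart (M := (L : ℝ) ^ k) hMr1 hε hc1 hcn1 hcnc hsmall hX hX1 hX₂ hX₂0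
  -- the one-scale Uhlenbeck chart (gen 93)
  obtain ⟨u, A, hu, hexp, hskew, hAle, hLan⟩ := cube_landau_chart hU hη hSF R z hc1' hc2' (by rw [hcn] at hc3'; exact hc3')
  -- the sup currency
  set a₀ : ℝ := 737280 * ε / (L : ℝ) ^ k with ha₀def
  have ha₀0 : 0 ≤ a₀ := by positivity
  have hA_a₀ : ∀ (x : Site 4) (κ : Fin 4), (∀ i, |x i - z i| ≤ (R : ℤ)) → ‖A x κ‖ ≤ a₀ := fun x κ hx => (hAle x κ hx).trans hc4'
  obtain ⟨hjεb, hG₁b, hΛb, hregb, ha₀4⟩ := raw_bounds (M := (L : ℝ) ^ k) (CJ := CJ) hMr1 hε hc1 hCJ hCJc hsmall ha₀0 le_rfl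
  -- the gauged configuration `U^{u}`
  have hWε : SmallField (gaugeAct u U) (ε / ((L : ℝ) ^ k) ^ 2) := smallField_gaugeAct hu hSF
  have hcovW : ∀ (ν : Fin 4) (y : Site 4), ‖covDiv 1 (gaugeAct u U) ν y‖ ≤ CJ * ε / ((L : ℝ) ^ k) ^ 3 := fun ν y => by
    rw [norm_covDiv_gaugeAct 1 (fun y => mem_U1_of_unitary (hu y)) U ν y]; exact hcov ν y
  -- the cube of radius `S = 16M + 4` and its relation to the chart cube of radius `R = 16M + 5`
  set S : ℤ := ((16 * L ^ k + 4 : ℕ) : ℤ) with hSdef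
  have hSR : ∀ y : Site 4, (∀ i, |y i - z i| ≤ S) → ∀ i, |y i - z i| ≤ (R : ℤ) := fun y hy => near_mono hy (by rw [hSdef, hRdef]; push_cast; omega)
  have hSR' : ∀ y : Site 4, (∀ i, |y i - z i| ≤ S) → ∀ κ : Fin 4, ∀ i, |(y - e κ) i - z i| ≤ (R : ℤ) := fun y hy κ =>
    near_mono (near_trans (near_sub_e y κ) hy) (by rw [hSdef, hRdef]; push_cast; omega)
  have hWexp : ∀ y : Site 4, (∀ i, |y i - z i| ≤ S) → ∀ κ : Fin 4, gaugeAct u U y κ = expUnit (A y κ) := fun y hy κ => hexp y κ (hSR y hy)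
  have hAS : ∀ y : Site 4, (∀ i, |y i - z i| ≤ S) → ∀ κ : Fin 4, ‖A y κ‖ ≤ a₀ := fun y hy κ => hA_a₀ y κ (hSR y hy)
  -- the `sinh`-Landau condition on the cube of radius `S`
  have hH : ∀ (y : Site 4) (κ : Fin 4), (∀ i, |y i - z i| ≤ (R : ℤ)) → (exp (A y κ))ᴴ = exp (-A y κ) := fun y κ hy => by
    have hsk : (A y κ)ᴴ = -A y κ := by rw [← Matrix.star_eq_conjTranspose]; exact skewAdjoint.mem_iff.mp (hskew y κ hy)
    rw [← Matrix.exp_conjTranspose, hsk]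
  have hEL : ∀ y : Site 4, (∀ i, |y i - z i| ≤ S) →
      ∑ κ : Fin 4, (((2 : ℂ)⁻¹ • (exp (A y κ) - exp (-A y κ))) - ((2 : ℂ)⁻¹ • (exp (A (y - e κ) κ) - exp (-A (y - e κ) κ)))) = 0 := by
    intro y hy
    have h := hLan y (hSR y hy)
    have hterm : ∀ κ : Fin 4, ((((gaugeAct u U y κ : (Matrix n n ℂ)ˣ) : Matrix n n ℂ) - ((gaugeAct u U y κ : (Matrix n n ℂ)ˣ) : Matrix n n ℂ)ᴴ)
          - (((gaugeAct u U (y - e κ) κ : (Matrix n n ℂ)ˣ) : Matrix n n ℂ) - ((gaugeAct u U (y - e κ) κ : (Matrix n n ℂ)ˣ) : Matrix n n ℂ)ᴴ))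
        = (exp (A y κ) - exp (-A y κ)) - (exp (A (y - e κ) κ) - exp (-A (y - e κ) κ)) := by
      intro κ
      have e1 : ((gaugeAct u U y κ : (Matrix n n ℂ)ˣ) : Matrix n n ℂ) = exp (A y κ) := by rw [hexp y κ (hSR y hy), val_expUnit]
      have e2 : ((gaugeAct u U (y - e κ) κ : (Matrix n n ℂ)ˣ) : Matrix n n ℂ) = exp (A (y - e κ) κ) := by rw [hexp (y - e κ) κ (hSR' y hy κ), val_expUnit]
      rw [e1, e2, hH y κ (hSR y hy), hH (y - e κ) κ (hSR' y hy κ)]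
    rw [Finset.sum_congr rfl (fun κ _ => hterm κ)] at h
    simp_rw [← smul_sub]
    rw [← Finset.smul_sum, h, smul_zero]
  -- G3a at `R₀ = 16M`
  have hR₀2 : 2 ≤ 16 * L ^ k := by omega
  have hR₀S : ((16 * L ^ k : ℕ) : ℤ) + 4 ≤ S := by rw [hSdef]; push_cast; omega
  have hR₀cast : ((16 * L ^ k : ℕ) : ℝ) = 16 * (L : ℝ) ^ k := by push_cast; ring
  have hreg : 144 * ((4 : ℕ) : ℝ) * a₀ * ((16 * L ^ k : ℕ) : ℝ) ≤ 1 := by rw [hR₀cast]; push_cast; linarith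
  obtain ⟨h92, h10, h93⟩ := hG3a (gaugeAct u U) A z S (ε / ((L : ℝ) ^ k) ^ 2) a₀ (CJ * ε / ((L : ℝ) ^ k) ^ 3) hη.le ha₀0 ha₀4 (by positivity)
    hWε hcovW hWexp hAS hEL (16 * L ^ k) hR₀2 hR₀S hreg
  refine ⟨u, A, hu, hexp, hskew, fun x κ hx => (hA_a₀ x κ hx).trans (le_of_eq (by rw [ha₀def])), ?_, ?_, ?_, ?_⟩
  · -- (9)₂
    intro x hx κ τ
    have h := h92 x hx κ τ
    rw [hR₀cast] at h
    push_cast at h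
    exact h.trans hG₁b
  · -- (10) at `R₁ = 7M`
    intro y hy ν
    have h := h10 (7 * L ^ k) (by omega) y hy ν
    rw [hR₀cast] at h
    push_cast at h
    exact h.trans hΛb
  · -- the `∂^{η*}∂^η A` clause of (10): the curl-divergence (J) of G1b at `x₀ = z`, `R = 7M`, with the half-cube gradient bound
    intro y hy ν
    have hLk : (0 : ℤ) ≤ (L : ℤ) ^ k := by positivity
    have hfit : ∀ y' : Site 4, (∀ i, |y' i - z i| ≤ ((7 * L ^ k : ℕ) : ℤ) + 3) → ∀ i, |y' i - z i| ≤ S :=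
      fun y' hy' => near_mono hy' (by rw [hSdef]; push_cast; linarith)
    have hG : ∀ y' : Site 4, (∀ i, |y' i - z i| ≤ ((7 * L ^ k : ℕ) : ℤ) + 1) → ∀ κ τ : Fin 4,
        ‖A (y' + e τ) κ - A y' κ‖ ≤ 36 * ((4 : ℕ) : ℝ) * a₀ / ((16 * L ^ k : ℕ) : ℝ)
          + 4 * ((16 * L ^ k : ℕ) : ℝ) * (CJ * ε / ((L : ℝ) ^ k) ^ 3 + ((4 : ℕ) : ℝ) * (ε / ((L : ℝ) ^ k) ^ 2 * (Real.exp a₀ - 1) * (2 + (Real.exp a₀ - 1))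
            + 2 * (ε / ((L : ℝ) ^ k) ^ 2) * (ε / ((L : ℝ) ^ k) ^ 2) * (2 + ε / ((L : ℝ) ^ k) ^ 2))) := by
      intro y' hy'
      have h1 : supNorm (y' - z) ≤ 7 * L ^ k + 1 := (near_iff_supNorm (R := 7 * L ^ k + 1)).1 (by push_cast; exact hy')
      exact h92 y' (by omega)
    obtain ⟨hJ, -⟩ := local_curl_div_bounds (gaugeAct u U) A z S hη.le ha₀0 hWε hcovW hWexp hAS hEL z (7 * L ^ k) hfit hG
    have h := hJ y ((near_iff_supNorm (R := 7 * L ^ k)).2 hy) ν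
    rw [hR₀cast] at h
    push_cast at h
    refine h.trans (le_trans ?_ hΛb)
    -- `(J) ≤ Λ`: the reaction part `2·4(e^{a₀}−1)·G₁` is nonnegative
    have hb0 : 0 ≤ Real.exp a₀ - 1 := by linarith [Real.add_one_le_exp a₀]
    have hb4 : 0 ≤ Real.exp (4 * a₀) - 1 := by linarith [Real.add_one_le_exp (4 * a₀)]
    have hG₁0 : 0 ≤ 36 * 4 * a₀ / (16 * (L : ℝ) ^ k) + 4 * (16 * (L : ℝ) ^ k) * (CJ * ε / ((L : ℝ) ^ k) ^ 3
        + 4 * (ε / ((L : ℝ) ^ k) ^ 2 * (Real.exp a₀ - 1) * (2 + (Real.exp a₀ - 1)) + 2 * (ε / ((L : ℝ) ^ k) ^ 2) * (ε / ((L : ℝ) ^ k) ^ 2) * (2 + ε / ((L : ℝ) ^ k) ^ 2))) := by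
      positivity
    have hnn := mul_nonneg (mul_nonneg (by norm_num : (0:ℝ) ≤ 2 * 4) hb0) hG₁0
    linarith only [hnn]
  · -- (9)₃ at `m = M`
    intro β hβ0 hβ1 z₁ z₂ hz₁ hz₂ μ κ
    have h := h93 (L ^ k) hMn1 (by omega) β hβ0 hβ1 z₁ z₂ hz₁ hz₂ μ κ
    rw [hR₀cast, hMcast] at h
    push_cast at h
    refine h.trans ?_
    have hε' : 0 < 1 - β := by linarith
    have hb : (0 : ℝ) ≤ 1 + (1 - β)⁻¹ := by positivity
    have hh : (0 : ℝ) ≤ (supNorm (z₁ - z₂) : ℝ) ^ β := Real.rpow_nonneg (by positivity) _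
    have hsc := rpow_scaling (m := L ^ k) hMn1 hβ0
    rw [hMcast] at hsc
    -- the bracket: `Λ + a₀/M² ≤ (C_J + 2 + 737280) ε / M³`
    have ha₀M : a₀ / ((L : ℝ) ^ k) ^ 2 = 737280 * ε / ((L : ℝ) ^ k) ^ 3 := by rw [ha₀def]; field_simp
    have hbr : (CJ * ε / ((L : ℝ) ^ k) ^ 3
          + 4 * (ε / ((L : ℝ) ^ k) ^ 2 * (Real.exp a₀ - 1) * (2 + (Real.exp a₀ - 1)) + 2 * (ε / ((L : ℝ) ^ k) ^ 2) * (ε / ((L : ℝ) ^ k) ^ 2) * (2 + ε / ((L : ℝ) ^ k) ^ 2))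
          + (4 * 4 * (Real.exp (4 * a₀) - 1) + 2 * 4 * (Real.exp a₀ - 1))
            * (36 * 4 * a₀ / (16 * (L : ℝ) ^ k) + 4 * (16 * (L : ℝ) ^ k) * (CJ * ε / ((L : ℝ) ^ k) ^ 3
              + 4 * (ε / ((L : ℝ) ^ k) ^ 2 * (Real.exp a₀ - 1) * (2 + (Real.exp a₀ - 1)) + 2 * (ε / ((L : ℝ) ^ k) ^ 2) * (ε / ((L : ℝ) ^ k) ^ 2) * (2 + ε / ((L : ℝ) ^ k) ^ 2))))
          + a₀ / ((L : ℝ) ^ k) ^ 2)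
        ≤ (CJ + 2 + 737280) * ε / ((L : ℝ) ^ k) ^ 3 := by
      rw [ha₀M]
      have e : (CJ + 2 + 737280) * ε / ((L : ℝ) ^ k) ^ 3 = (CJ + 2) * ε / ((L : ℝ) ^ k) ^ 3 + 737280 * ε / ((L : ℝ) ^ k) ^ 3 := by ring
      rw [e]; linarith
    have hbr0 : 0 ≤ (CJ + 2 + 737280) * ε / ((L : ℝ) ^ k) ^ 3 := by positivity
    have hK : 0 ≤ C * (1 + (1 - β)⁻¹) := by positivity
    calc C * (1 + (1 - β)⁻¹)
          * ((CJ * ε / ((L : ℝ) ^ k) ^ 3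
              + 4 * (ε / ((L : ℝ) ^ k) ^ 2 * (Real.exp a₀ - 1) * (2 + (Real.exp a₀ - 1)) + 2 * (ε / ((L : ℝ) ^ k) ^ 2) * (ε / ((L : ℝ) ^ k) ^ 2) * (2 + ε / ((L : ℝ) ^ k) ^ 2))
              + (4 * 4 * (Real.exp (4 * a₀) - 1) + 2 * 4 * (Real.exp a₀ - 1))
                * (36 * 4 * a₀ / (16 * (L : ℝ) ^ k) + 4 * (16 * (L : ℝ) ^ k) * (CJ * ε / ((L : ℝ) ^ k) ^ 3
                  + 4 * (ε / ((L : ℝ) ^ k) ^ 2 * (Real.exp a₀ - 1) * (2 + (Real.exp a₀ - 1)) + 2 * (ε / ((L : ℝ) ^ k) ^ 2) * (ε / ((L : ℝ) ^ k) ^ 2) * (2 + ε / ((L : ℝ) ^ k) ^ 2))))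
              + a₀ / ((L : ℝ) ^ k) ^ 2))
          * (3 * (L : ℝ) ^ k) ^ (1 - β) * (supNorm (z₁ - z₂) : ℝ) ^ β
        ≤ C * (1 + (1 - β)⁻¹) * ((CJ + 2 + 737280) * ε / ((L : ℝ) ^ k) ^ 3) * (3 * (L : ℝ) ^ k) ^ (1 - β) * (supNorm (z₁ - z₂) : ℝ) ^ β := by
          apply mul_le_mul_of_nonneg_right _ hh
          apply mul_le_mul_of_nonneg_right _ (Real.rpow_nonneg (by positivity) _)
          exact mul_le_mul_of_nonneg_left hbr hK
      _ = C * (1 + (1 - β)⁻¹) * ((CJ + 2 + 737280) * ε) * ((3 * (L : ℝ) ^ k) ^ (1 - β) / ((L : ℝ) ^ k) ^ 3) * (supNorm (z₁ - z₂) : ℝ) ^ β := by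
          ring
      _ ≤ C * (1 + (1 - β)⁻¹) * ((CJ + 2 + 737280) * ε) * (3 / ((L : ℝ) ^ k) ^ (2 + β)) * (supNorm (z₁ - z₂) : ℝ) ^ β := by
          apply mul_le_mul_of_nonneg_right _ hh
          exact mul_le_mul_of_nonneg_left hsc (by positivity)
      _ = 3 * C * (CJ + 2 + 737280) * (1 + (1 - β)⁻¹) * ε * (supNorm (z₁ - z₂) : ℝ) ^ β / ((L : ℝ) ^ k) ^ (2 + β) := by ring


end

end Summit.QuantumFields.BalabanUV.T4Continuum.NE7AllMinimisersCubeReg910Full
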